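import Summits.Ventures.YMGap.FlowData.RectTubeMagneticTwist
import Summits.Ventures.YMGap.FlowData.RectTubeCentreRescaling
import Summits.Ventures.YMGap.FlowData.RectTubeTranslationInvariance
import HarnessLib

/-!
# Venture YMGap, track Y3 FLOW-DATA — the magnetic twist is a CLASS MODULO COBOUNDARIES and translation invariant:
# `E_mag(ζ·U(γ)) = E_mag(ζ)` for every central link field `γ`, `E_mag(ζ(· − v)) = E_mag(ζ)` (theorems only)

HONEST FRAMING: venture file of the cell `pub-ymgap` (QuantumFields programme), track Y3 (FLOW-DATA); companion THEOREMS for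
`FlowData/RectTubeMagneticTwist.lean` (FLOW-PLAN O6 typed).  Finite spatial torus, compact second-countable `G`, continuous `ρ`;
no number, no row, nothing about `L → ∞`, the continuum or a mass gap; the sign of `E_mag` is not claimed.

* `rectMagSumTw_linkRescale`, `rectSliceKernelTw_linkRescale` — `K_ζ(γ·a, γ·b) = K_{ζ·U(γ)}(a, b)` for central `γ`
  (`U_q(γ)` = plaquette holonomy of the link field = its coboundary);
* **`norm_rectTubeTwistedOperator_linkRescale`**, **`rectMagneticFluxEnergy_linkRescale`** — `‖T_{ζ·U(γ)}‖ = ‖T_ζ‖`,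
  `E_mag(ζ·U(γ)) = E_mag(ζ)`: twists differing by a coboundary are unitarily equivalent (change of variables `a ↦ γ·a`,
  `RectTubeCentreRescaling.norm_kernelOp_eq_of_conj`) — on a `2`-torus cross-section only the product `∏_q ζ_q` of a central
  `ℤ₂`-twist matters, as for 't Hooft's flux; `rectMagneticFluxEnergy_coboundary`: `E_mag(U(γ)) = 0`;
* `rectMagSumTw_translate`, `rectSliceKernelTw_translate`, **`norm_rectTubeTwistedOperator_translate`**,
  **`rectMagneticFluxEnergy_translate`** — translating the twist field does not change `E_mag`; the cell's case
  **`su2RectMagneticFluxEnergy_translate`**: `E_mag(β; Ls; S + v) = E_mag(β; Ls; S)` (the FLOW-TABLE's single twisted plaquette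
  may sit anywhere).

References: G. 't Hooft, Nucl. Phys. B 153 (1979) 141 [cite: tHooft1979Flux]; E. T. Tomboulis, L. G. Yaffe, Commun. Math. Phys. 100
(1985) 313 [cite: TomboulisYaffe1985]; M. Lüscher, Commun. Math. Phys. 54 (1977) 283 [cite: Luscher1977].
-/

noncomputable section

open scoped BigOperators ENNReal
open MeasureTheory Filter Function
open Literature.MathematicalPhysics.QuantumFieldTheory Literature.Analysis.OperatorTheory
open Literature.MathematicalPhysics.QuantumLattice (RectTorusSite fundamentalRep continuous_fundamentalRep)
open Summit.Ventures.YMGap.Census (RectPlaquette rectPlaquetteHolonomy)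

namespace Summit.Ventures.YMGap.FlowData

/-! ### Coboundaries -/

section Coboundary

variable {G : Type*} [Group G] {n k : ℕ} (ρ : G →* Matrix (Fin n) (Fin n) ℂ) {Ls : Fin k → ℕ} [∀ i, NeZero (Ls i)]

/-- The twisted magnetic sum of the rescaled slice is the magnetic sum twisted by `ζ · U(γ)` (central `γ`). [cite: tHooft1979Flux] -/
theorem rectMagSumTw_linkRescale {γ : RectSlice Ls G} (hγ : ∀ e, γ e ∈ Subgroup.center G) (ζ : RectPlaquette Ls → G)
    (a : RectSlice Ls G) :
    rectMagSumTw ρ ζ (rectLinkRescale γ a) = rectMagSumTw ρ (fun q => ζ q * rectPlaquetteHolonomy γ q.1 q.2.1.1 q.2.1.2) a := by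
  unfold rectMagSumTw
  simp only [rectPlaquetteHolonomy_linkRescale hγ, mul_assoc]

variable [TopologicalSpace G] [IsTopologicalGroup G] [CompactSpace G] [MeasurableSpace G] [BorelSpace G]

/-- **Kernel covariance**: `K_ζ(γ·a, γ·b) = K_{ζ·U(γ)}(a, b)` for central `γ`. [cite: tHooft1979Flux] -/
theorem rectSliceKernelTw_linkRescale {γ : RectSlice Ls G} (hγ : ∀ e, γ e ∈ Subgroup.center G) (ζ : RectPlaquette Ls → G)
    (JE JM : ℝ) (a b : RectSlice Ls G) :
    rectSliceKernelTw ρ ζ JE JM (rectLinkRescale γ a) (rectLinkRescale γ b) =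
      rectSliceKernelTw ρ (fun q => ζ q * rectPlaquetteHolonomy γ q.1 q.2.1.1 q.2.1.2) JE JM a b := by
  unfold rectSliceKernelTw
  simp only [rectMagSumTw_linkRescale ρ hγ, rectElecSum_linkRescale ρ hγ]

variable [SecondCountableTopology G] {J : ℝ}

/-- **COBOUNDARY INVARIANCE OF THE TWISTED NORM: `‖T_{ζ·U(γ)}‖ = ‖T_ζ‖`** for every central link field `γ` (the twisted
operators are intertwined by the unitary change of variables `a ↦ γ·a`). [cite: tHooft1979Flux] -/
theorem norm_rectTubeTwistedOperator_linkRescale (hρ : Continuous ρ) {γ : RectSlice Ls G}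
    (hγ : ∀ e, γ e ∈ Subgroup.center G) (ζ : RectPlaquette Ls → G) :
    ‖rectTubeTwistedOperator ρ J Ls (fun q => ζ q * rectPlaquetteHolonomy γ q.1 q.2.1.1 q.2.1.2)‖ =
      ‖rectTubeTwistedOperator ρ J Ls ζ‖ :=
  norm_kernelOp_eq_of_conj (measurePreserving_rectLinkRescale γ) (measurePreserving_rectLinkRescale γ⁻¹)
    (rectLinkRescale_inv_rectLinkRescale γ) (rectLinkRescale_rectLinkRescale_inv γ)
    (stronglyMeasurable_rectSliceKernelTw ρ hρ ζ J J) (rectSliceKernelTw_linkRescale ρ hγ ζ J J)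
    (rectTubeTwistedOperator_ae_eq hρ ζ) (rectTubeTwistedOperator_ae_eq hρ _)

/-- **COBOUNDARY INVARIANCE OF `E_mag`: `E_mag(ζ·U(γ)) = E_mag(ζ)`** for every central link field `γ` — the magnetic twist is a
class modulo coboundaries (on a `2`-torus: only `∏_q ζ_q` matters for a central `ℤ₂`-twist). [cite: tHooft1979Flux] -/
theorem rectMagneticFluxEnergy_linkRescale (hρ : Continuous ρ) {γ : RectSlice Ls G} (hγ : ∀ e, γ e ∈ Subgroup.center G)
    (ζ : RectPlaquette Ls → G) :
    rectMagneticFluxEnergy ρ J Ls (fun q => ζ q * rectPlaquetteHolonomy γ q.1 q.2.1.1 q.2.1.2) =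
      rectMagneticFluxEnergy ρ J Ls ζ := by
  unfold rectMagneticFluxEnergy
  rw [norm_rectTubeTwistedOperator_linkRescale ρ hρ hγ]

/-- **A pure coboundary twist costs nothing: `E_mag(U(γ)) = 0`** for every central link field `γ` (e.g. for `G = SU(2)`,
`γ = −1` on one link `e` and `1` elsewhere: twisting every plaquette through `e` an odd number of times is invisible).
[cite: tHooft1979Flux] -/
theorem rectMagneticFluxEnergy_coboundary (hρ : Continuous ρ) {γ : RectSlice Ls G} (hγ : ∀ e, γ e ∈ Subgroup.center G) :
    rectMagneticFluxEnergy ρ J Ls (fun q => rectPlaquetteHolonomy γ q.1 q.2.1.1 q.2.1.2) = 0 := by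
  have h := rectMagneticFluxEnergy_linkRescale ρ (J := J) hρ hγ 1
  simp only [Pi.one_apply, one_mul] at h
  rw [h]
  exact rectMagneticFluxEnergy_one hρ

end Coboundary

/-! ### Translations -/

section Translate

variable {G : Type*} [Group G] {n k : ℕ} (ρ : G →* Matrix (Fin n) (Fin n) ℂ) {Ls : Fin k → ℕ}

/-- Plaquettes of the translated slice: `U_{x,ij}(τ_v a) = U_{x+v,ij}(a)`. [folklore] -/
theorem rectPlaquetteHolonomy_rectTranslate (v : RectTorusSite Ls) (a : RectSlice Ls G) (x : RectTorusSite Ls) (i j : Fin k) :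
    rectPlaquetteHolonomy (rectTranslate v a) x i j = rectPlaquetteHolonomy a (x + v) i j := by
  unfold rectPlaquetteHolonomy
  simp only [rectTranslate_apply, add_right_comm _ _ v]

variable [∀ i, NeZero (Ls i)]

/-- The twisted magnetic sum of the translated slice is the magnetic sum twisted by the translated field
`ζ(· − v)`. [folklore] -/
theorem rectMagSumTw_translate (v : RectTorusSite Ls) (ζ : RectPlaquette Ls → G) (a : RectSlice Ls G) :
    rectMagSumTw ρ ζ (rectTranslate v a) = rectMagSumTw ρ (fun q => ζ (q.1 - v, q.2)) a := by
  unfold rectMagSumTw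
  conv_rhs => rw [← Equiv.sum_comp (Equiv.addRight v)]
  refine Finset.sum_congr rfl fun x _ => Finset.sum_congr rfl fun p _ => ?_
  simp only [rectPlaquetteHolonomy_rectTranslate, Equiv.coe_addRight, add_sub_cancel_right]

variable [TopologicalSpace G] [IsTopologicalGroup G] [CompactSpace G] [MeasurableSpace G] [BorelSpace G]

/-- **Kernel covariance under translations**: `K_ζ(τ_v a, τ_v b) = K_{ζ(·−v)}(a, b)`. [cite: Luscher1977] -/
theorem rectSliceKernelTw_translate (v : RectTorusSite Ls) (ζ : RectPlaquette Ls → G) (JE JM : ℝ) (a b : RectSlice Ls G) :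
    rectSliceKernelTw ρ ζ JE JM (rectTranslate v a) (rectTranslate v b) =
      rectSliceKernelTw ρ (fun q => ζ (q.1 - v, q.2)) JE JM a b := by
  unfold rectSliceKernelTw
  rw [rectMagSumTw_translate, rectMagSumTw_translate]
  congr 2
  simp_rw [rectElecSum_translate ρ v a b]
  exact integral_comp_sub_site v (fun E => Real.exp (JE * rectElecSum ρ a E b))

variable [SecondCountableTopology G] {J : ℝ}

/-- **`‖T_{ζ(·−v)}‖ = ‖T_ζ‖`**: translating the twist field does not change the twisted norm. [cite: Luscher1977] -/
theorem norm_rectTubeTwistedOperator_translate (hρ : Continuous ρ) (v : RectTorusSite Ls) (ζ : RectPlaquette Ls → G) :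
    ‖rectTubeTwistedOperator ρ J Ls (fun q => ζ (q.1 - v, q.2))‖ = ‖rectTubeTwistedOperator ρ J Ls ζ‖ :=
  norm_kernelOp_eq_of_conj (σ := rectTranslate v) (σ' := rectTranslate (-v)) (measurePreserving_rectTranslate v)
    (measurePreserving_rectTranslate (-v))
    (fun a => by rw [← rectTranslate_add, neg_add_cancel, rectTranslate_zero])
    (fun a => by rw [← rectTranslate_add, add_neg_cancel, rectTranslate_zero])
    (stronglyMeasurable_rectSliceKernelTw ρ hρ ζ J J) (rectSliceKernelTw_translate ρ v ζ J J)
    (rectTubeTwistedOperator_ae_eq hρ ζ) (rectTubeTwistedOperator_ae_eq hρ _)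

/-- **`E_mag(ζ(·−v)) = E_mag(ζ)`**. [cite: Luscher1977] -/
theorem rectMagneticFluxEnergy_translate (hρ : Continuous ρ) (v : RectTorusSite Ls) (ζ : RectPlaquette Ls → G) :
    rectMagneticFluxEnergy ρ J Ls (fun q => ζ (q.1 - v, q.2)) = rectMagneticFluxEnergy ρ J Ls ζ := by
  unfold rectMagneticFluxEnergy
  rw [norm_rectTubeTwistedOperator_translate ρ hρ]

end Translate

/-! ### The cell's case: the twisted plaquette set may be translated freely -/

section SU2

variable {k : ℕ} {Ls : Fin k → ℕ}

/-- The twist field of the translated plaquette set `S + v` is the translated twist field. [folklore] -/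
theorem su2PlaquetteTwist_image_add [∀ i, NeZero (Ls i)] (S : Finset (RectPlaquette Ls)) (v : RectTorusSite Ls) :
    su2PlaquetteTwist (S.image fun q => (q.1 + v, q.2)) = fun q => su2PlaquetteTwist S (q.1 - v, q.2) := by
  classical
  funext q
  have hmem : (q ∈ S.image fun q => (q.1 + v, q.2)) ↔ (q.1 - v, q.2) ∈ S := by
    rw [Finset.mem_image]
    constructor
    · rintro ⟨q', hq', rfl⟩
      simpa only [add_sub_cancel_right] using hq'
    · intro h
      exact ⟨(q.1 - v, q.2), h, by simp only [sub_add_cancel, Prod.mk.eta]⟩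
  by_cases h : (q.1 - v, q.2) ∈ S
  · unfold su2PlaquetteTwist
    rw [if_pos (hmem.2 h), if_pos h]
  · rw [su2PlaquetteTwist_of_not_mem _ h, su2PlaquetteTwist_of_not_mem _ (fun h' => h (hmem.1 h'))]

/-- **`E_mag(β; Ls; S + v) = E_mag(β; Ls; S)`**: the cell's magnetic-flux energy does not depend on where the twisted plaquettes
sit, only on the set up to translation (and, by `rectMagneticFluxEnergy_linkRescale`, up to coboundaries). [cite: tHooft1979Flux] -/
theorem su2RectMagneticFluxEnergy_translate (β : ℝ) (Ls : Fin k → ℕ) [∀ i, NeZero (Ls i)] (S : Finset (RectPlaquette Ls))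
    (v : RectTorusSite Ls) :
    su2RectMagneticFluxEnergy β Ls (S.image fun q => (q.1 + v, q.2)) = su2RectMagneticFluxEnergy β Ls S := by
  haveI : SecondCountableTopology (Matrix.specialUnitaryGroup (Fin 2) ℂ) :=
    Literature.MathematicalPhysics.QuantumLattice.secondCountableTopology_su2
  unfold su2RectMagneticFluxEnergy
  rw [su2PlaquetteTwist_image_add]
  exact rectMagneticFluxEnergy_translate _ (continuous_fundamentalRep (Fin 2)) v _

end SU2

end Summit.Ventures.YMGap.FlowData
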